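import Mathlib
import Literature.Probability.Percolation.Percolation
import Literature.Probability.Percolation.IkhlefPonsaingFirstPassageProofs
import Literature.Probability.Percolation.DiagonalStripColumns
import Literature.Probability.Percolation.DiagonalColumnPatterns
import Literature.Probability.Percolation.DiagonalStripJunction
import Literature.Probability.Percolation.DiagonalStripTransferLaw
import Literature.Probability.Percolation.DiagonalStripDoeblin
import Literature.Combinatorics.Enumerative.SymplecticCharacterVSASM
import HarnessLib

/-!
# The stationary law of the diagonal percolation strip; Ikhlef–Ponsaing's passage probability as a
# stationary pairing; reduction of Prop. 4.7 to the `q`KZ identity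

Topic `Literature/Probability/Percolation`. Completes dictionary step (i) of the named fact
`Literature.Probability.Percolation.IkhlefPonsaingFirstPassage` (Ikhlef–Ponsaing, J. Stat. Phys.
149 (2012), arXiv:1202.5476, §3.1, Def. 4.1, Props. 4.5, 4.7):

* `lawAt0 m M` (law of the pattern at column `0` of the strip truncated at `-M`),
  `dist_lawAt0_succ_le`, `cauchySeq_lawAt0` (Doeblin), **`ipStationary m`** — the stationary law
  (IP12's normalised ground state `Ψ` in the cluster language) with `tendsto_lawAt0`,
  `ipStationary_nonneg`, `sum_ipStationary`, **`pushLaw_pushLaw_ipStationary`** (`π = π T₀ T₁`,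
  IP12 eq. (TPsi) at `n = 1`) and **`eq_ipStationary_of_fixed`** (uniqueness: "the ground state is
  unique", §3.4);
* **`real_ipPassage_eq_sum_ipStationary`** — THE DICTIONARY: for every site `b` of level `2m`,
  `P_{1/2}(b ↔ wall in the strip 0 ≤ x₀+x₁ ≤ 2m+1) = ∑_{P,P'} π(P) π(P') J(P, P')`
  (IP12 Def. 4.1, `P_b = ⟨Ψ|ρ|Ψ⟩/⟨Ψ|Ψ⟩`), from `tendsto_ipPassage_trunc` (event side) and
  `real_wall_ipSeg_eq_sum` + convergence of the laws (law side);
* **`ikhlefPonsaingFirstPassage_iff_stationary_pairing`** — the named fact is EQUIVALENT to the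
  finite-dimensional identities `∑_{P,P'} π_m(P) π_m(P') J_m(P,P') = ipSpDim(2m) ipSpDim(2m+2) /
  ipSpDim(2m+1)²` (`m ∈ ℕ`), i.e. to IP12's `⟨Ψ|ρ|Ψ⟩/⟨Ψ|Ψ⟩ = χ_{L-1} χ_{L+1} / χ_L²` at the
  homogeneous point — the `q`KZ computation of §3.3–§4.4, which is what remains to be formalised
  (the stochastic matrices `T_c` are explicit: probabilities of finitely determined events;
  `DiagonalStripTransferExplicit.lean` writes them as `2^{-(2m+1)}` times `0/1` counts);
* `IsValid`, `colUpdate_isValid`, `ipTransfer_eq_zero_of_not_isValid`,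
  `ipStationary_eq_zero_of_not_isValid` — the update always produces VALID patterns (equivalence
  relation, wall contact a union of classes, bottom site on the wall at even columns), so `T_c` and
  `π` are supported on them (first step of the identification with IP12's link patterns `LP_L`).

## References

* Y. Ikhlef, A. K. Ponsaing, J. Stat. Phys. 149 (2012) 10–36, arXiv:1202.5476, §3.1, §3.4,
  Def. 4.1, Props. 4.5, 4.7. [IkhlefPonsaing2012]
-/

namespace Literature.Probability.Percolation

open Literature.Probability.LatticeModels

/-! ### The stationary law and the infinite-strip passage probability -/

section Limit

open MeasureTheory Filter Topology

variable {m : ℕ}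

/-- The law of the pattern at column `0` of the strip truncated at column `-M`. [cite: IkhlefPonsaing2012, §3.1] -/
noncomputable def lawAt0 (m : ℕ) (M : ℕ) : ColPattern m → ℝ := iterLaw m (-(M : ℤ)) M

/-- The push of a nonnegative vector is nonnegative. [folklore] -/
theorem pushLaw_nonneg (c : ℤ) {μ : ColPattern m → ℝ} (hμ : ∀ P, 0 ≤ μ P) (P' : ColPattern m) :
    0 ≤ pushLaw m c μ P' :=
  Finset.sum_nonneg fun P _ => mul_nonneg (hμ P) (ipTransfer_nonneg c P P')

/-- Consecutive laws at column `0` differ by at most `2 (1 - ε_m)^M`: both are `M` pushes of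
probability vectors. [folklore] -/
theorem dist_lawAt0_succ_le (M : ℕ) :
    dist (lawAt0 m M) (lawAt0 m (M + 1)) ≤ 2 * (1 - (1 / 2 : ℝ) ^ ((m + 1) * (m + 1))) ^ M := by
  have h0 : lawAt0 m M = pushIter m (-(M : ℤ)) (iterLaw m (-(M : ℤ)) 0) M := iterLaw_eq_pushIter _ _
  have h1 : lawAt0 m (M + 1) =
      pushIter m (-(M : ℤ)) (pushLaw m (-(M : ℤ) - 1) (iterLaw m (-(M : ℤ) - 1) 0)) M := by
    unfold lawAt0
    rw [iterLaw_eq_pushIter, show (-((M + 1 : ℕ) : ℤ)) = -(M : ℤ) - 1 by push_cast; ring,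
      pushIter_succ_left, show -(M : ℤ) - 1 + 1 = -(M : ℤ) by ring]
  rw [h0, h1]
  refine (dist_le_l1 _ _).trans ((l1_pushIter_sub_le _ _ _ ?_ M).trans ?_)
  · rw [sum_pushLaw, sum_iterLaw, sum_iterLaw]
  · have h2 : l1 (iterLaw m (-(M : ℤ)) 0 - pushLaw m (-(M : ℤ) - 1) (iterLaw m (-(M : ℤ) - 1) 0)) ≤ 2 :=
      l1_sub_le_two (iterLaw_nonneg _ _) (pushLaw_nonneg _ (iterLaw_nonneg _ _)) (sum_iterLaw _ _)
        (by rw [sum_pushLaw, sum_iterLaw])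
    have hq : 0 ≤ (1 - (1 / 2 : ℝ) ^ ((m + 1) * (m + 1))) ^ M :=
      pow_nonneg (sub_nonneg.2 (pow_le_one₀ (by norm_num : (0 : ℝ) ≤ 1 / 2) (by norm_num : (1 / 2 : ℝ) ≤ 1))) _
    calc (1 - (1 / 2 : ℝ) ^ ((m + 1) * (m + 1))) ^ M *
          l1 (iterLaw m (-(M : ℤ)) 0 - pushLaw m (-(M : ℤ) - 1) (iterLaw m (-(M : ℤ) - 1) 0))
        ≤ (1 - (1 / 2 : ℝ) ^ ((m + 1) * (m + 1))) ^ M * 2 := mul_le_mul_of_nonneg_left h2 hq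
      _ = _ := mul_comm _ _

/-- The laws at column `0` form a Cauchy sequence as the truncation recedes. [folklore] -/
theorem cauchySeq_lawAt0 : CauchySeq (lawAt0 m) :=
  cauchySeq_of_le_geometric _ _ (sub_lt_self _ (by positivity)) (dist_lawAt0_succ_le (m := m))

/-- **The stationary law of the column patterns** (IP12's ground state `Ψ`, normalised, in the
cluster language): the limit of the laws at column `0` as the truncation recedes to `-∞`.
[cite: IkhlefPonsaing2012, §3.1] -/
noncomputable def ipStationary (m : ℕ) : ColPattern m → ℝ := limUnder atTop (lawAt0 m)

/-- The laws at column `0` converge to the stationary law. [cite: IkhlefPonsaing2012, §3.1] -/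
theorem tendsto_lawAt0 : Tendsto (lawAt0 m) atTop (𝓝 (ipStationary m)) :=
  (cauchySeq_lawAt0 (m := m)).tendsto_limUnder

/-- Componentwise convergence to the stationary law. [folklore] -/
theorem tendsto_lawAt0_apply (P : ColPattern m) :
    Tendsto (fun M => lawAt0 m M P) atTop (𝓝 (ipStationary m P)) :=
  (tendsto_pi_nhds.1 tendsto_lawAt0) P

/-- The stationary law is nonnegative. [folklore] -/
theorem ipStationary_nonneg (P : ColPattern m) : 0 ≤ ipStationary m P :=
  ge_of_tendsto' (tendsto_lawAt0_apply P) fun _ => iterLaw_nonneg _ _ _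

/-- The stationary law is a probability vector. [folklore] -/
theorem sum_ipStationary : ∑ P, ipStationary m P = 1 :=
  tendsto_nhds_unique (tendsto_finsetSum _ fun P _ => tendsto_lawAt0_apply P)
    (by simp only [lawAt0, sum_iterLaw]; exact tendsto_const_nhds)

/-- `(c + N).toNat → ∞` as `N → ∞`. [folklore] -/
theorem tendsto_toNat_add_atTop (c : ℤ) : Tendsto (fun N : ℕ => (c + N).toNat) atTop atTop := by
  refine tendsto_atTop_atTop.2 fun M => ⟨M + c.natAbs, fun N hN => ?_⟩
  omega

/-- A site of level `2m` is the top site `colSite c m` of its column `c = x₀ - x₁` (even). [folklore] -/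
theorem eq_colSite_of_level {m : ℕ} {b : Site 2} (hb : b 0 + b 1 = 2 * m) :
    b = colSite (b 0 - b 1) ((Fin.last m : Fin (m + 1)) : ℕ) := by
  rw [Fin.val_last]
  ext i
  fin_cases i
  · show b 0 = colSite (b 0 - b 1) m 0
    rw [colSite_zero]; omega
  · show b 1 = colSite (b 0 - b 1) m 1
    rw [colSite_one]; omega

/-- **The infinite-strip dictionary** (IP12 §3.1 + Def. 4.1 for the cluster event of the named
fact): for every site `b` of level `2m`, the probability that `b` is joined to the wall inside the
strip `0 ≤ x₀ + x₁ ≤ 2m+1` is the pairing `∑_{P, P'} π(P) π(P') J(P, P')` of the stationary law of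
the column patterns with itself through the junction functional at the top site (`P_b = ⟨Ψ|ρ|Ψ⟩/⟨Ψ|Ψ⟩`).
[cite: IkhlefPonsaing2012, §3.1, Def. 4.1] -/
theorem real_ipPassage_eq_sum_ipStationary (m : ℕ) (b : Site 2) (hb : b 0 + b 1 = 2 * m) :
    (bondPercolation (zdGraph 2) half).real {ω | ∃ w : Site 2, w 0 + w 1 = 0 ∧
        ω ∈ openConnIn {x : Site 2 | 0 ≤ x 0 + x 1 ∧ x 0 + x 1 ≤ ((2 * m + 1 : ℕ) : ℤ)} b w} =
      ∑ P : ColPattern m, ∑ P' : ColPattern m,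
        ipStationary m P * ipStationary m P' * (if ipJunction m (Fin.last m) P P' = true then 1 else 0) := by
  set c := b 0 - b 1 with hc
  have hceven : c % 2 = 0 := by omega
  have hbeq := eq_colSite_of_level hb
  rw [← hc] at hbeq
  have hlim1 := tendsto_ipPassage_trunc (bondPercolation (zdGraph 2) half) m b
  -- the finite-volume probabilities, eventually, as pairings of laws at column 0
  have hev : ∀ᶠ N : ℕ in atTop,
      (bondPercolation (zdGraph 2) half).real {ω | ∃ w : Site 2, w 0 + w 1 = 0 ∧
        ω ∈ openConnIn ({x : Site 2 | 0 ≤ x 0 + x 1 ∧ x 0 + x 1 ≤ ((2 * m + 1 : ℕ) : ℤ)} ∩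
          {x : Site 2 | |x 0 - x 1| ≤ (N : ℤ)}) b w} =
      ∑ P : ColPattern m, ∑ P' : ColPattern m,
        lawAt0 m (c + N).toNat P * lawAt0 m (-c + N).toNat P' *
          (if ipJunction m (Fin.last m) P P' = true then 1 else 0) := by
    refine eventually_atTop.2 ⟨c.natAbs, fun N hN => ?_⟩
    rw [ipStrip_inter_abs_le_eq_ipSeg, hbeq, real_wall_ipSeg_eq_sum m (by omega) (by omega)]
    have hL : iterLaw m (-(N : ℤ)) (c - -(N : ℤ)).toNat = lawAt0 m (c + N).toNat := by
      unfold lawAt0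
      rw [show c - -(N : ℤ) = c + N by ring,
        show (-(N : ℤ)) = -(((c + N).toNat : ℕ) : ℤ) + 2 * (c / 2) by
          rw [Int.toNat_of_nonneg (by omega)]; omega]
      exact iterLaw_add_two_mul _ _ _
    have hR : iterLaw m (-(N : ℤ)) ((N : ℤ) - c).toNat = lawAt0 m (-c + N).toNat := by
      unfold lawAt0
      rw [show (N : ℤ) - c = -c + N by ring,
        show (-(N : ℤ)) = -(((-c + N).toNat : ℕ) : ℤ) + 2 * (-(c / 2)) by
          rw [Int.toNat_of_nonneg (by omega)]; omega]
      exact iterLaw_add_two_mul _ _ _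
    rw [hL, hR]
  have hlim2 : Tendsto (fun N : ℕ => ∑ P : ColPattern m, ∑ P' : ColPattern m,
        lawAt0 m (c + N).toNat P * lawAt0 m (-c + N).toNat P' *
          (if ipJunction m (Fin.last m) P P' = true then 1 else 0)) atTop
      (𝓝 (∑ P : ColPattern m, ∑ P' : ColPattern m,
        ipStationary m P * ipStationary m P' * (if ipJunction m (Fin.last m) P P' = true then 1 else 0))) := by
    refine tendsto_finsetSum _ fun P _ => tendsto_finsetSum _ fun P' _ => ?_
    refine ((((tendsto_lawAt0_apply P).comp (tendsto_toNat_add_atTop c)).mul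
      ((tendsto_lawAt0_apply P').comp (tendsto_toNat_add_atTop (-c)))).mul_const _)
  exact tendsto_nhds_unique hlim1 (hlim2.congr' (hev.mono fun N hN => hN.symm))

end Limit

/-! ### The stationary law is the Perron vector of the two-step transfer matrix -/

section Stationary

open Filter Topology

variable {m : ℕ}

/-- The push is continuous (a linear map of a finite-dimensional space). [folklore] -/
theorem continuous_pushLaw (c : ℤ) : Continuous (pushLaw m c) :=
  continuous_pi fun _ => continuous_finsetSum _ fun P _ => (continuous_apply P).mul continuous_const

/-- Two more columns: `lawAt0 (M+2) = (lawAt0 M) T₀ T₁` (periodicity and translation). [folklore] -/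
theorem lawAt0_add_two (M : ℕ) : lawAt0 m (M + 2) = pushLaw m 1 (pushLaw m 0 (lawAt0 m M)) := by
  unfold lawAt0
  have hs : ∀ (a : ℤ) (n : ℕ), iterLaw m a (n + 1) = pushLaw m (a + n) (iterLaw m a n) :=
    fun a n => funext fun P' => iterLaw_succ a n P'
  rw [hs, hs]
  have e1 : (-((M + 2 : ℕ) : ℤ) + (M + 1 : ℕ)) = 1 + 2 * (-1) := by push_cast; ring
  have e0 : (-((M + 2 : ℕ) : ℤ) + (M : ℕ)) = 0 + 2 * (-1) := by push_cast; ring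
  have eM : (-((M + 2 : ℕ) : ℤ)) = -(M : ℤ) + 2 * (-1) := by push_cast; ring
  rw [e1, e0, pushLaw_add_two_mul, pushLaw_add_two_mul, eM, iterLaw_add_two_mul]

/-- **Stationarity**: `π = π T₀ T₁`. [cite: IkhlefPonsaing2012, §3.1, eq. (TPsi)] -/
theorem pushLaw_pushLaw_ipStationary : pushLaw m 1 (pushLaw m 0 (ipStationary m)) = ipStationary m := by
  have h1 : Tendsto (fun M => lawAt0 m (M + 2)) atTop (𝓝 (ipStationary m)) :=
    tendsto_lawAt0.comp (tendsto_add_atTop_nat 2)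
  have h2 : Tendsto (fun M => lawAt0 m (M + 2)) atTop (𝓝 (pushLaw m 1 (pushLaw m 0 (ipStationary m)))) := by
    simp only [lawAt0_add_two]
    exact ((continuous_pushLaw 1).comp (continuous_pushLaw 0)).continuousAt.tendsto.comp tendsto_lawAt0
  exact tendsto_nhds_unique h2 h1

/-- **Uniqueness of the stationary law** (Perron–Frobenius by Doeblin contraction): a vector of
total mass `1` fixed by `T₀ T₁` is `π`. [cite: IkhlefPonsaing2012, §3.4 ("the ground state is unique")] -/
theorem eq_ipStationary_of_fixed (ν : ColPattern m → ℝ) (hν1 : ∑ P, ν P = 1)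
    (hfix : pushLaw m 1 (pushLaw m 0 ν) = ν) : ν = ipStationary m := by
  set ε := (1 / 2 : ℝ) ^ ((m + 1) * (m + 1)) with hε
  have hε0 : 0 < ε := by positivity
  have hε1 : ε ≤ 1 := pow_le_one₀ (by norm_num) (by norm_num)
  set x := ν - ipStationary m with hx
  have hx0 : ∑ P, x P = 0 := by
    simp only [hx, Pi.sub_apply, Finset.sum_sub_distrib, hν1, sum_ipStationary, sub_self]
  have hx0' : ∑ P, pushLaw m 0 x P = 0 := by rw [sum_pushLaw, hx0]
  have hcontr : l1 x ≤ (1 - ε) * ((1 - ε) * l1 x) := by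
    have : x = pushLaw m 1 (pushLaw m 0 x) := by
      rw [hx, ← pushLaw_sub, ← pushLaw_sub, hfix, pushLaw_pushLaw_ipStationary]
    calc l1 x = l1 (pushLaw m 1 (pushLaw m 0 x)) := by rw [← this]
      _ ≤ (1 - ε) * l1 (pushLaw m 0 x) := l1_pushLaw_le 1 _ hx0'
      _ ≤ (1 - ε) * ((1 - ε) * l1 x) := mul_le_mul_of_nonneg_left (l1_pushLaw_le 0 _ hx0) (sub_nonneg.2 hε1)
  have hl1nn : 0 ≤ l1 x := Finset.sum_nonneg fun P _ => abs_nonneg _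
  have hpos : 0 < 1 - (1 - ε) * (1 - ε) := by nlinarith
  have hl1 : l1 x = 0 := by
    by_contra hne
    have hpos' : 0 < l1 x := lt_of_le_of_ne hl1nn (Ne.symm hne)
    have key : 0 < l1 x * (1 - (1 - ε) * (1 - ε)) := mul_pos hpos' hpos
    nlinarith [key, hcontr]
  have hxz : ∀ P, x P = 0 := by
    intro P
    have := (Finset.sum_eq_zero_iff_of_nonneg fun P _ => abs_nonneg (x P)).1 hl1 P (Finset.mem_univ P)
    exact abs_eq_zero.1 this
  funext P
  have := hxz P
  rw [hx, Pi.sub_apply, sub_eq_zero] at this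
  exact this

end Stationary

/-! ### What remains of Ikhlef–Ponsaing's Prop. 4.7: the stationary pairing in character form -/

section Remaining

open Literature.Combinatorics.Enumerative

/-- The top site of column `0` has level `2m`. [folklore] -/
theorem colSite_zero_last_level (m : ℕ) :
    colSite 0 ((Fin.last m : Fin (m + 1)) : ℕ) 0 + colSite 0 ((Fin.last m : Fin (m + 1)) : ℕ) 1 = 2 * (m : ℤ) := by
  rw [colSite_add, Fin.val_last]
  norm_num

/-- **Ikhlef–Ponsaing's Prop. 4.7, reduced to the transfer-matrix identity.** With the dictionary
(`real_ipPassage_eq_sum_ipStationary`) and Di Francesco's evaluations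
(`ikhlefPonsaingFirstPassage_iff_character_form`), the named fact `IkhlefPonsaingFirstPassage` is
EQUIVALENT to the statement that, for every `m`, the stationary pairing of the width-`(2m+1)`
diagonal strip equals `χ_{2m}(1) χ_{2m+2}(1) / χ_{2m+1}(1)²` (Weyl-dimension rendering `ipSpDim`):
`∑_{P,P'} π_m(P) π_m(P') J_m(P, P') = ipSpDim(2m) ipSpDim(2m+2) / ipSpDim(2m+1)²`, where `π_m` is the
unique probability vector fixed by the two-step transfer matrix `T₀ T₁` (`eq_ipStationary_of_fixed`).
This is IP12's `⟨Ψ|ρ|Ψ⟩/⟨Ψ|Ψ⟩ = χ_{L-1} χ_{L+1} / χ_L²` at the homogeneous point (Def. 4.1 +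
Prop. 4.5), i.e. exactly the `q`KZ computation (§3.3–§4.4), which is what remains to be formalised.
[cite: IkhlefPonsaing2012, Def. 4.1, Props. 4.5, 4.7] -/
theorem ikhlefPonsaingFirstPassage_iff_stationary_pairing :
    IkhlefPonsaingFirstPassage ↔ ∀ m : ℕ,
      ∑ P : ColPattern m, ∑ P' : ColPattern m,
        ipStationary m P * ipStationary m P' * (if ipJunction m (Fin.last m) P P' = true then 1 else 0) =
      ((ipSpDim (2 * m) * ipSpDim (2 * m + 2) / ipSpDim (2 * m + 1) ^ 2 : ℚ) : ℝ) := by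
  rw [ikhlefPonsaingFirstPassage_iff_character_form]
  constructor
  · intro h m
    rw [← real_ipPassage_eq_sum_ipStationary m _ (colSite_zero_last_level m)]
    exact h m _ (colSite_zero_last_level m)
  · intro h m b hb
    rw [real_ipPassage_eq_sum_ipStationary m b hb]
    exact h m

end Remaining

/-! ### Valid patterns: the support of the transfer matrix and of the stationary law -/

section Valid

variable {m : ℕ}

/-- A **valid** column pattern at a column of parity `c`: the connection relation is an
equivalence relation, wall contact is a union of classes, and at an even column the bottom site
(which lies on the wall) touches the wall. Every pattern produced by the update is valid, whatever
the input. [cite: IkhlefPonsaing2012, §3.1] -/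
structure IsValid (c : ℤ) (P : ColPattern m) : Prop where
  refl : ∀ i, P.1 i i = true
  symm : ∀ i j, P.1 i j = true → P.1 j i = true
  trans : ∀ i j k, P.1 i j = true → P.1 j k = true → P.1 i k = true
  wall : ∀ i j, P.1 i j = true → P.2 i = true → P.2 j = true
  bottom : c % 2 = 0 → P.2 0 = true

/-- **The update lands in valid patterns**, for every input pattern and every edge layer. [cite: IkhlefPonsaing2012, §3.1] -/
theorem colUpdate_isValid (c : ℤ) (P : ColPattern m) (E : Fin (m + 1) → Fin (m + 1) → Bool) :
    IsValid (c + 1) (colUpdate m c P E) := by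
  classical
  refine ⟨fun i => ?_, fun i j h => ?_, fun i j k h1 h2 => ?_, fun i j h hw => ?_, fun hc => ?_⟩ <;>
    simp only [colUpdate, decide_eq_true_eq] at *
  · exact Relation.EqvGen.refl _
  · exact Relation.EqvGen.symm _ _ h
  · exact Relation.EqvGen.trans _ _ _ h1 h2
  · obtain ⟨z, hz, hzw⟩ := hw
    exact ⟨z, Relation.EqvGen.trans _ _ _ (Relation.EqvGen.symm _ _ h) hz, hzw⟩
  · exact ⟨Sum.inr 0, Relation.EqvGen.refl _, by simp [updWall, hc]⟩

/-- The bare-column pattern is valid. [folklore] -/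
theorem colInit_isValid (c : ℤ) : IsValid c (colInit m c) := by
  classical
  refine ⟨fun i => ?_, fun i j h => ?_, fun i j k h1 h2 => ?_, fun i j h hw => ?_, fun hc => ?_⟩ <;>
    simp only [colInit, decide_eq_true_eq] at *
  · exact h.symm
  · exact h1.trans h2
  · rw [← h]; exact hw
  · exact ⟨hc, rfl⟩

/-- The iterated patterns are valid. [folklore] -/
theorem colIter_isValid (a : ℤ) (E : ℤ → Fin (m + 1) → Fin (m + 1) → Bool) (n : ℕ) :
    IsValid (a + n) (colIter m a E n) := by
  cases n with
  | zero => simpa [colIter] using colInit_isValid (m := m) a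
  | succ n =>
    rw [colIter, show a + ((n + 1 : ℕ) : ℤ) = a + n + 1 by push_cast; ring]
    exact colUpdate_isValid _ _ _

open MeasureTheory

/-- **The transfer matrix is supported on valid patterns**: `T_c(P, P') = 0` unless `P'` is valid
at parity `c + 1`. [cite: IkhlefPonsaing2012, §3.1] -/
theorem ipTransfer_eq_zero_of_not_isValid (c : ℤ) (P P' : ColPattern m) (h : ¬ IsValid (c + 1) P') :
    ipTransfer m c P P' = 0 := by
  unfold ipTransfer
  have : {ω : BondConfig (Site 2) | colUpdate m c P (colEdges ω m c) = P'} = ∅ :=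
    Set.eq_empty_of_forall_notMem fun ω hω => h (hω ▸ colUpdate_isValid c P _)
  rw [this, measureReal_empty]

/-- The iterated laws are supported on valid patterns. [folklore] -/
theorem iterLaw_eq_zero_of_not_isValid (a : ℤ) (n : ℕ) (P : ColPattern m) (h : ¬ IsValid (a + n) P) :
    iterLaw m a n P = 0 := by
  unfold iterLaw
  have : {ω : BondConfig (Site 2) | colIter m a (colEdges ω m) n = P} = ∅ :=
    Set.eq_empty_of_forall_notMem fun ω hω => h (hω ▸ colIter_isValid a _ n)
  rw [this, measureReal_empty]

/-- **The stationary law is supported on valid even-column patterns.** [cite: IkhlefPonsaing2012, §3.1] -/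
theorem ipStationary_eq_zero_of_not_isValid (P : ColPattern m) (h : ¬ IsValid 0 P) : ipStationary m P = 0 := by
  refine tendsto_nhds_unique (tendsto_lawAt0_apply P) ?_
  have : (fun M => lawAt0 m M P) = fun _ => 0 := by
    funext M
    unfold lawAt0
    exact iterLaw_eq_zero_of_not_isValid _ _ _ (by simpa using h)
  rw [this]
  exact tendsto_const_nhds

end Valid

end Literature.Probability.Percolation
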